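import Summits.Ventures.PercRepro.Night2FatYD1Loads

/-!
# night-2: the fat case under the distance-1 hypothesis — the free point, the collinear `W ∖ {x}`, four unloaded level-3 targets

`basis_pair_fair_fat_of_free_point_generic`, `basis_pair_fair_fat_of_collinear_of_generic` and
`four_le_unloaded_level_three_sum` (gen 33) under the distance-1 hypothesis `hD1` of the pair (`Night2FatYD1Loads`)
in place of generic off-points.  Paper `proofs/NIGHT-2-g34.md` §1.
-/

namespace PercRepro.Shadow

open PercRepro.ThmH PercRepro.PerFlat

variable {α : Type*} [DecidableEq α] {M : Matroid α} [M.Finite] {G : Finset α}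

/-- **The fat case of (FAIR) with generic off-points from a point of `W` off the basis lines** (`N ≥ 8`). -/
theorem basis_pair_fair_fat_of_free_point_of_D1 (hG : G ∈ flatsQ M (5 + 1)) (hd : (gr M \ G).card = 2)
    (hk : kColoops M G = 1) (hs : ∀ e ∈ gr M, ∀ f ∈ gr M, e ≠ f → rkN M {e, f} = 2)
    (hl : ∀ e ∈ gr M, M.Indep {e}) (hfat : (fatClosures M 5 G 2).card ≤ 1)
    {B₀ : Finset α} (hB₀ : B₀ ∈ thinMembers M 5 G) {w₀ x : α} (hD : G \ clF M B₀ = {w₀, x}) (hne : w₀ ≠ x)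
    {B : Finset α} (hB : B ∈ thinMembers M 5 G) (hnP : ¬ bigP M G B) {z : α} (hz : z ∈ G \ clF M B)
    (hD1 : ∀ T ∈ tgtSets M 5 G B z, x ∈ T → dload M 5 G (bigP M G) (dshGT2 M 5 G) T ≠ 0 →
      ∃ R ⊆ (T \ coloops M G) \ {w₀, x}, rkN M R = 2 ∧ 3 ≤ R.card ∧ R.card + 4 = (T \ coloops M G).card ∧
        3 ≤ rkN M (G \ T))
    (hl0 : loss M 5 G B z ≠ 0) (hw₀ : w₀ ∈ insert z B) (hx : x ∉ insert z B) {y : α}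
    (hy : y ∈ G \ insert z B) (hxy : x ≠ y) (hN : 8 ≤ (G \ insert z B).card)
    (hfree : ∀ a ∈ (insert z B \ coloops M G).erase w₀, ∀ b ∈ (insert z B \ coloops M G).erase w₀, a ≠ b →
      rkN M {a, b, y} = 3) :
    loss M 5 G B z ≤ rhoL M 5 G B z * lossIncomeH M 5 G (bigP M G) (dshGT2 M 5 G) B z :=
  basis_pair_fair_fat_of_free_point hG hd hk hs hl hfat hB₀ hD hne hB hnP hz hl0 hw₀ hx hy hxy hN
    (fun _ hT hxT hyT => dload_eq_zero_of_free_of_D1 hG hd hk hs hB hnP hz hD1 hx hy hxy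
      hfree hT hxT hyT)

/-- **The fat case of (FAIR) with generic off-points when `W ∖ {x}` lies on a line.** -/
theorem basis_pair_fair_fat_of_collinear_of_D1 (hG : G ∈ flatsQ M (5 + 1)) (hd : (gr M \ G).card = 2)
    (hk : kColoops M G = 1) (hs : ∀ e ∈ gr M, ∀ f ∈ gr M, e ≠ f → rkN M {e, f} = 2)
    (hl : ∀ e ∈ gr M, M.Indep {e}) (hfat : (fatClosures M 5 G 2).card ≤ 1)
    {B₀ : Finset α} (hB₀ : B₀ ∈ thinMembers M 5 G) {w₀ x : α} (hD : G \ clF M B₀ = {w₀, x}) (hne : w₀ ≠ x)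
    {B : Finset α} (hB : B ∈ thinMembers M 5 G) (hnP : ¬ bigP M G B) {z : α} (hz : z ∈ G \ clF M B)
    (hD1 : ∀ T ∈ tgtSets M 5 G B z, x ∈ T → dload M 5 G (bigP M G) (dshGT2 M 5 G) T ≠ 0 →
      ∃ R ⊆ (T \ coloops M G) \ {w₀, x}, rkN M R = 2 ∧ 3 ≤ R.card ∧ R.card + 4 = (T \ coloops M G).card ∧
        3 ≤ rkN M (G \ T))
    (hl0 : loss M 5 G B z ≠ 0) (hw₀ : w₀ ∈ insert z B) (hx : x ∉ insert z B)
    (hcol : rkN M ((G \ insert z B).erase x) ≤ 2) :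
    loss M 5 G B z ≤ rhoL M 5 G B z * lossIncomeH M 5 G (bigP M G) (dshGT2 M 5 G) B z :=
  basis_pair_fair_fat_of_unloaded hG hd hk hs hl hfat hB₀ hD hne hB hnP hz hl0 hw₀ hx
    (fun _ hT hxT => dload_eq_zero_of_collinear_of_D1 hD1 hcol hT hxT)

/-- **Four unloaded level-3 targets at `N = 6`** from a point `y₁` of a basis line carrying at most two points of
`W ∖ {x}` and a point `y₂` off that line: the level-3 sum is at least `4 · fatTerm 3 1`. -/
theorem four_le_unloaded_level_three_sum_of_D1 (hG : G ∈ flatsQ M (5 + 1)) (hd : (gr M \ G).card = 2)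
    (hk : kColoops M G = 1) (hs : ∀ e ∈ gr M, ∀ f ∈ gr M, e ≠ f → rkN M {e, f} = 2)
    (hl : ∀ e ∈ gr M, M.Indep {e}) {B₀ : Finset α}
    {w₀ x : α} (hD : G \ clF M B₀ = {w₀, x}) {B : Finset α} (hB : B ∈ thinMembers M 5 G) (hnP : ¬ bigP M G B) {z : α} (hz : z ∈ G \ clF M B)
    (hD1 : ∀ T ∈ tgtSets M 5 G B z, x ∈ T → dload M 5 G (bigP M G) (dshGT2 M 5 G) T ≠ 0 →
      ∃ R ⊆ (T \ coloops M G) \ {w₀, x}, rkN M R = 2 ∧ 3 ≤ R.card ∧ R.card + 4 = (T \ coloops M G).card ∧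
        3 ≤ rkN M (G \ T)) (hx : x ∈ G \ insert z B) (hN : (G \ insert z B).card = 6) {y₁ : α} (hy₁ : y₁ ∈ (G \ insert z B).erase x)
    {a b : α} (ha : a ∈ (insert z B \ coloops M G).erase w₀) (hb : b ∈ (insert z B \ coloops M G).erase w₀)
    (hab : a ≠ b) (hline : rkN M {a, b, y₁} ≤ 2)
    (ht : (((G \ insert z B).erase x).filter (fun y => rkN M (insert y {a, b}) ≤ 2)).card ≤ 2)
    {y₂ : α} (hy₂ : y₂ ∈ (G \ insert z B).erase x) (hoff : ¬ rkN M (insert y₂ {a, b}) ≤ 2) :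
    4 * fatTerm 3 1 ≤   ∑ T ∈ ((tgtSets M 5 G B z).filter
        (fun T => x ∈ T ∧ dload M 5 G (bigP M G) (dshGT2 M 5 G) T = 0)).filter
        (fun T => (T \ insert z B).card = 3),
        capS M 5 G T / ((221 / 360 : ℚ) * ((2 * ((T \ coloops M G).card - 2).choose 4 : ℕ) : ℚ)) := by
  have hd' : (gr M \ G).card ≤ 5 := by omega
  have hBm : B ∈ membersIn M (Uq M (5 + 2) 5) G := (mem_thinMembers.1 hB).1
  have hy₁x : y₁ ≠ x := (Finset.mem_erase.1 hy₁).1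
  have hxQ : x ∉ insert z B := (Finset.mem_sdiff.1 hx).2
  set L := ((G \ insert z B).erase x).filter (fun y => rkN M (insert y {a, b}) ≤ 2) with hL
  have hy₁L : y₁ ∈ L := by
    rw [hL, Finset.mem_filter, insert_pair_eq']
    exact ⟨hy₁, hline⟩
  set F := ((tgtSets M 5 G B z).filter
    (fun T => x ∈ T ∧ dload M 5 G (bigP M G) (dshGT2 M 5 G) T = 0)).filter
    (fun T => (T \ insert z B).card = 3) with hF
  -- every term of `F` is at least `fatTerm 3 1`
  have hterm : ∀ T ∈ F, fatTerm 3 1 ≤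
      capS M 5 G T / ((221 / 360 : ℚ) * ((2 * ((T \ coloops M G).card - 2).choose 4 : ℕ) : ℚ)) := by
    intro T hT
    rw [hF, Finset.mem_filter, Finset.mem_filter] at hT
    obtain ⟨⟨hTt, -, -⟩, hTj⟩ := hT
    have hTK : (T \ coloops M G).card = 3 + 5 := by
      rw [card_sdiff_coloops_eq_level_add_five hG hd hk hB hnP hz hTt, hTj]
    have hGT := card_sdiff_add_card_sdiff_of_mem_tgtSets hTt
    have hcap : (1 : ℚ) ≤ capS M 5 G T := by
      rw [capS_eq_one_of_card_sdiff_le_three hd (by omega)]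
    unfold fatTerm
    rw [hTK]
    apply div_le_div_of_nonneg_right hcap
    positivity
  have hpos : 0 ≤ fatTerm 3 1 := by
    unfold fatTerm
    positivity
  -- the unloaded targets through `x, y₁` at level `3`
  have hX : ({x, y₁} : Finset α) ⊆ G \ insert z B := by
    intro e he
    rw [Finset.mem_insert, Finset.mem_singleton] at he
    rcases he with rfl | rfl
    · exact hx
    · exact Finset.mem_of_mem_erase hy₁
  have hX2 : ({x, y₁} : Finset α).card = 2 := Finset.card_pair hy₁x.symm
  have hcount := choose_le_card_targets_level hG hB hz hX (by norm_num : 1 ≤ 3) (by rw [hX2]; norm_num)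
  rw [hX2, hN] at hcount
  norm_num at hcount
  set A := (tgtSets M 5 G B z).filter (fun T => ({x, y₁} : Finset α) ⊆ T ∧ (T \ insert z B).card = 3) with hA
  have hsplit := Finset.card_filter_add_card_filter_not
    (s := A) (fun T => dload M 5 G (bigP M G) (dshGT2 M 5 G) T = 0)
  have hloaded := card_loaded_targets_through_le_of_D1 hG hd hk hs hl hB hnP hz hD1 hxQ hy₁ ha hb hab hline 3
  rw [← hL] at hloaded
  have hloadsub : A.filter (fun T => ¬ dload M 5 G (bigP M G) (dshGT2 M 5 G) T = 0) ⊆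
      (tgtSets M 5 G B z).filter (fun T => ({x, y₁} : Finset α) ⊆ T ∧ (T \ insert z B).card = 3 ∧
        dload M 5 G (bigP M G) (dshGT2 M 5 G) T ≠ 0) := by
    intro T hT
    rw [Finset.mem_filter, hA, Finset.mem_filter] at hT
    rw [Finset.mem_filter]
    exact ⟨hT.1.1, hT.1.2.1, hT.1.2.2, hT.2⟩
  have hl' := le_trans (Finset.card_le_card hloadsub) hloaded
  have hLe : (L.erase y₁).card + 1 = L.card := by
    rw [Finset.card_erase_of_mem hy₁L]
    have : 0 < L.card := Finset.card_pos.2 ⟨y₁, hy₁L⟩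
    omega
  have hLe1 : (L.erase y₁).card.choose (3 - 2) = (L.erase y₁).card := by
    simp only [show (3 : ℕ) - 2 = 1 from rfl, Nat.choose_one_right]
  rw [hLe1] at hl'
  set U := A.filter (fun T => dload M 5 G (bigP M G) (dshGT2 M 5 G) T = 0) with hU
  have hUsub : U ⊆ F := by
    intro T hT
    rw [hU, Finset.mem_filter, hA, Finset.mem_filter] at hT
    rw [hF, Finset.mem_filter, Finset.mem_filter]
    exact ⟨⟨hT.1.1, hT.1.2.1 (Finset.mem_insert_self _ _), hT.2⟩, hT.1.2.2⟩
  have hUcard : 5 ≤ U.card + L.card := by omega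
  -- the sum over `F` dominates the sum over any sub-family of `F`
  have hsumF : ∀ S ⊆ F, (S.card : ℚ) * fatTerm 3 1 ≤ ∑ T ∈ F,
      capS M 5 G T / ((221 / 360 : ℚ) * ((2 * ((T \ coloops M G).card - 2).choose 4 : ℕ) : ℚ)) := by
    intro S hS
    calc (S.card : ℚ) * fatTerm 3 1 = ∑ _T ∈ S, fatTerm 3 1 := by rw [Finset.sum_const, nsmul_eq_mul]
      _ ≤ ∑ T ∈ S, capS M 5 G T / ((221 / 360 : ℚ) * ((2 * ((T \ coloops M G).card - 2).choose 4 : ℕ) : ℚ)) :=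
          Finset.sum_le_sum (fun T hT => hterm T (hS hT))
      _ ≤ _ := by
          apply Finset.sum_le_sum_of_subset_of_nonneg hS
          intro T _ _
          exact div_nonneg (capS_nonneg' hG hd' T) (by positivity)
  rcases Nat.lt_or_ge L.card 2 with h1 | h2
  · -- `t₁ = 1`: four unloaded targets through `y₁`
    have h4 : (4 : ℚ) ≤ (U.card : ℚ) := by exact_mod_cast (by omega : 4 ≤ U.card)
    calc 4 * fatTerm 3 1 ≤ (U.card : ℚ) * fatTerm 3 1 := mul_le_mul_of_nonneg_right h4 hpos
      _ ≤ _ := hsumF U hUsub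
  · -- `t₁ = 2`: three through `y₁` and the target `Q ∪ {x, y₁′, y₂}`
    have hL2 : L.card = 2 := by omega
    obtain ⟨y₁', hy₁'⟩ : (L.erase y₁).Nonempty := by
      rw [← Finset.card_pos]
      omega
    have hy₁'y₁ : y₁' ≠ y₁ := (Finset.mem_erase.1 hy₁').1
    have hy₁'L : y₁' ∈ L := Finset.mem_of_mem_erase hy₁'
    have hy₁'W : y₁' ∈ (G \ insert z B).erase x := (Finset.mem_filter.1 hy₁'L).1
    have hy₁'line : rkN M {a, b, y₁'} ≤ 2 := by
      have := (Finset.mem_filter.1 hy₁'L).2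
      rwa [insert_pair_eq'] at this
    have hy₂L : y₂ ∉ L := fun h => hoff (Finset.mem_filter.1 h).2
    have hy₂y₁ : y₂ ≠ y₁ := fun h => hy₂L (h ▸ hy₁L)
    have hy₂y₁' : y₂ ≠ y₁' := fun h => hy₂L (h ▸ hy₁'L)
    have hy₁'x : y₁' ≠ x := (Finset.mem_erase.1 hy₁'W).1
    have hy₂x : y₂ ≠ x := (Finset.mem_erase.1 hy₂).1
    set T₀ := insert z B ∪ {x, y₁', y₂} with hT₀
    have hT₀t : T₀ ∈ tgtSets M 5 G B z := by
      rw [tgtSets_eq_image hG hBm hz, Finset.mem_image]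
      refine ⟨{x, y₁', y₂}, Finset.mem_filter.2 ⟨Finset.mem_powerset.2 ?_, ⟨x, Finset.mem_insert_self _ _⟩⟩, rfl⟩
      intro e he
      rw [Finset.mem_insert, Finset.mem_insert, Finset.mem_singleton] at he
      rcases he with rfl | rfl | rfl
      · exact hx
      · exact Finset.mem_of_mem_erase hy₁'W
      · exact Finset.mem_of_mem_erase hy₂
    have hXsub : ({x, y₁', y₂} : Finset α) ⊆ G \ insert z B := by
      intro e he
      rw [Finset.mem_insert, Finset.mem_insert, Finset.mem_singleton] at he
      rcases he with rfl | rfl | rfl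
      · exact hx
      · exact Finset.mem_of_mem_erase hy₁'W
      · exact Finset.mem_of_mem_erase hy₂
    have hT₀sd : T₀ \ insert z B = {x, y₁', y₂} := by
      rw [hT₀, Finset.union_sdiff_left]
      apply Finset.sdiff_eq_self_of_disjoint
      rw [Finset.disjoint_left]
      intro e he
      exact (Finset.mem_sdiff.1 (hXsub he)).2
    have hT₀c : (T₀ \ insert z B).card = 3 := by
      rw [hT₀sd, Finset.card_insert_of_notMem, Finset.card_pair hy₂y₁'.symm]
      rw [Finset.mem_insert, Finset.mem_singleton, not_or]
      exact ⟨hy₁'x.symm, hy₂x.symm⟩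
    have hxT₀ : x ∈ T₀ := Finset.mem_union_right _ (Finset.mem_insert_self _ _)
    have hy₁'T₀ : y₁' ∈ T₀ := Finset.mem_union_right _ (Finset.mem_insert_of_mem (Finset.mem_insert_self _ _))
    have hy₂T₀ : y₂ ∈ T₀ :=
      Finset.mem_union_right _ (Finset.mem_insert_of_mem (Finset.mem_insert_of_mem (Finset.mem_singleton_self _)))
    have hT₀unl : dload M 5 G (bigP M G) (dshGT2 M 5 G) T₀ = 0 :=
      dload_eq_zero_of_two_lines_of_D1 hG hd hk hs hl hB hnP hz hD1 hxQ hy₁'W hy₂ ha hb hab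
        hy₁'line hoff hT₀t hxT₀ hy₁'T₀ hy₂T₀
    have hT₀F : T₀ ∈ F := by
      rw [hF, Finset.mem_filter, Finset.mem_filter]
      exact ⟨⟨hT₀t, hxT₀, hT₀unl⟩, hT₀c⟩
    have hT₀U : T₀ ∉ U := by
      intro h
      rw [hU, Finset.mem_filter, hA, Finset.mem_filter] at h
      have hy₁T₀ : y₁ ∈ T₀ := h.1.2.1 (Finset.mem_insert_of_mem (Finset.mem_singleton_self _))
      have hy₁Q : y₁ ∉ insert z B := (Finset.mem_sdiff.1 (Finset.mem_of_mem_erase hy₁)).2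
      rw [hT₀, Finset.mem_union] at hy₁T₀
      rcases hy₁T₀ with h' | h'
      · exact hy₁Q h'
      · rw [Finset.mem_insert, Finset.mem_insert, Finset.mem_singleton] at h'
        rcases h' with h' | h' | h'
        · exact hy₁x h'
        · exact hy₁'y₁ h'.symm
        · exact hy₂y₁ h'.symm
    have hcard : 4 ≤ (insert T₀ U).card := by
      rw [Finset.card_insert_of_notMem hT₀U]
      omega
    have h4 : (4 : ℚ) ≤ ((insert T₀ U).card : ℚ) := by exact_mod_cast hcard
    calc 4 * fatTerm 3 1 ≤ ((insert T₀ U).card : ℚ) * fatTerm 3 1 := mul_le_mul_of_nonneg_right h4 hpos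
      _ ≤ _ := hsumF (insert T₀ U) (Finset.insert_subset hT₀F hUsub)

end PercRepro.Shadow
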